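import Literature.MathematicalPhysics.QuantumFieldTheory.ConformalBootstrap3D.RadialExpansionUniqueness
import Mathlib.Analysis.Analytic.Binomial
import Mathlib.Analysis.Normed.Ring.InfiniteSum
import Mathlib.RingTheory.Binomial
import HarnessLib

/-!
# The `z → ρ` conversion of a block expansion (Hogervorst–Rychkov 2013 §3, "first method")

Hogervorst–Rychkov 2013 §3 give two expansions of a conformal block: the `z`-series
`G = Σ_{n,j} A_{n,j} 𝒫_{Δ+n,j}(s_z, ξ_z)` (their eq. (3.4); in the tree `hrCoeff`/`hrCoeffAB`, `zMono`,
`BlockZSeries(AB)`) and the `ρ`-series `G = Σ_{n,j} B_{n,j} 𝒫_{Δ+n,j}(r,η)` (their eq. (3.5);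
in the tree the HYPOTHESIS `HasRadialExpansion`, `MixedOddRadial`), and describe the "first method" to
obtain `B` from `A`: substitute `z = 4ρ/(1+ρ)²` (their eq. (3.1)) into the `z`-series, "expanding the
denominators, we will get a power series of the form `Σ_n r^{Δ+n} Q_n(η)` … This will give `B_{n,j}` at
level `n` as a linear combination of `A_{n',j'}` for `n' ≤ n`." This file makes that a theorem, in the
form needed by a radial-frame certificate (pub-ising3d RADIAL-FRAME-DESIGN.md §3, REFEREE.md F82):

* `radialMonArr_eq_zRhoConv_of_hasSum` — if `G` has on the square `(0,1)²` a `z`-expansion with a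
  non-negative array `A` supported on `j ≤ ℓ + n` (`ℓ ≤ Δ`), and `((1-z)(1-z̄))^c·G` has a radial
  expansion with a table `w` supported on `j ≤ ℓ + m`, then the `(√ρ,√ρ̄)`-monomial array of `w`
  (`radialMonArr`, from `RadialExpansionUniqueness`) equals the explicit, point-independent CONVERSION
  ARRAY `zRhoConv c Δ ℓ A` — a finitely supported sum of products of `A_{n,j}`, `4^n`, the Legendre
  weights `λ_iλ_k` and generalized binomial coefficients (`convCoeff`). Hence `w` is determined by `A`
  (`RadialSupport.eq_of_radialMonArr_eq`).
* `IsConformalBlock3D.radialMonArr_eq_zRhoConv` — for a typed block of the conjugate-pair family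
  `Δ₁₂ = -Δ₃₄` (the `⟨εσσε⟩` block; `z`-array `hrCoeffAB (Δ₃₄/2) (Δ₃₄/2)/λ_ℓ ≥ 0`) at a regular `(Δ,ℓ)`:
  any supported radial table of `((1-z)(1-z̄))^c g` has monomial array `zRhoConv c Δ ℓ (A/λ_ℓ)`.
* `RadialPairClause.radialMonArr_eq_zRhoConv` — under the radial pair clause (the would-be A2ρ at one
  point) the clause's table is that conversion: the tables a radial head-cell rule would use are
  CONSEQUENCES of the typed `z`-frame data, not additional input.
* `zRhoConv_eq_sum_convBox` / `IsConformalBlock3D.radialMonArr_eq_sum_convBox` (§8) — under the support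
  condition the fibre sum `zRhoConv c Δ ℓ A (a,b)` is an explicit `Finset` sum over the box `convBox ℓ (a,b)`
  (`n ≤ a+b`, `j ≤ ℓ+a+b`, `i,t ≤ a`, `k,t' ≤ b`), i.e. directly evaluable in head cells.

Method (all absolute-convergence bookkeeping, no analytic continuation): at a point
`(z,z̄) = (z(s²), z(u²))` with `0 < s,u < √2 - 1` (i.e. `ρ,ρ̄ < 3 - 2√2`, Hogervorst–Rychkov §3.1:
`|z(ρ)/ρ| > 1`, and the substituted series regroups absolutely exactly when `4ρ/(1-ρ)² < 1`) one has
`z = (2s/(1+s²))²`, `1 - z = ((1-s²)/(1+s²))²` (`BlockRadialCoordinate`), so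
`(1-z)^c 𝒫_{Δ+n,j}(z,z̄) = (su)^{Δ-ℓ} 4^Δ Σ_{i+k=j} 4^n λ_iλ_k [s^{a₀}(1-s²)^{2c}(1+s²)^{-(Δ-ℓ+a₀)-2c}]·[u …]`,
`a₀ = ℓ+n-j+2i` (§2), and each bracket is a binomial-product series `Σ_t E(2c,β;t) s^{a₀+2t}` (§1,
from Mathlib's real binomial series `Real.one_add_rpow_hasFPowerSeriesOnBall_zero`), absolutely
dominated by `s^{a₀}(1-s²)^{-(|2c|+|β|)} ≤ (1-s²)^{-4|c|} s^{a₀}(1-s²)^{-(Δ-ℓ+a₀)}`; resumming the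
dominating family gives the `z`-series at the real point `((2s/(1-s²))², (2u/(1-u²))²)` of the square
(§4–§5), which converges by hypothesis. Regrouping the absolutely convergent total family by
`(s,u)`-degree (`HasSum.tsum_fiberwise`, §6) gives a double power series in `(s,u)`; the radial side is
a double power series in `(s,u)` by `hasSum_radialMonArr`; the identity theorem on `(0,√2-1)²`
(`eq_zero_of_double_tsum_eq_zero_of_pos`) identifies the coefficient arrays (§7).

What is NOT here: existence of a radial expansion of a typed block (A2ρ), positivity or parity of the
radial table (parity: `RadialTableParity`), the triangular solve expressing `w(m,j)` itself through
`radialMonArr` entries (only `RadialSupport.eq_of_radialMonArr_eq`), values of any coefficient.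

Sources: M. Hogervorst, S. Rychkov, Phys. Rev. D 87 (2013) 106004, arXiv:1303.1111, §3 eqs. (3.1),
(3.4)–(3.6), the "first method" paragraph, and §3.1; M. S. Costa, T. Hansen, J. Penedones, E. Trevisani,
JHEP 07 (2016) 057, arXiv:1603.05552, §2.1 eq. (2.7), (2.11). Mathlib: `Real.one_add_rpow_hasFPowerSeriesOnBall_zero`,
`binomialSeries`, `Ring.choose`, `descPochhammer`, `tsum_mul_tsum_eq_tsum_sum_antidiagonal_of_summable_norm`,
`summable_mul_of_summable_norm`, `HasSum.mul`, `summable_prod_of_nonneg`, `HasSum.prod_fiberwise`,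
`HasSum.tsum_fiberwise`. Tree: `RadialExpansionUniqueness` (`radialMonArr`, `hasSum_radialMonArr`,
`eq_zero_of_sum_radialArr_eq_zero`, `eq_zero_of_double_tsum_eq_zero_of_pos`), `BlockRadialCoordinate`
(`zOfRho_sq`, `one_sub_zOfRho_sq`, `rhoOf_zOfRho`), `BlockZSeriesAB` (`IsConformalBlock3D.hasSum_hrZTermAB`),
`MixedBlockCoefficients` (`hrCoeffAB_self_nonneg`, `hrCoeffAB_eq_zero_of_lt`).
-/


namespace Literature.MathematicalPhysics.QuantumFieldTheory.ConformalBootstrap3D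

open Finset Set Polynomial

/-! ### §1. One-dimensional binomial kernels -/

/-- `Ring.choose a n = a(a-1)⋯(a-n+1)/n!` over `ℝ`. [folklore] -/
theorem ring_choose_eq_descPochhammer_div (a : ℝ) (n : ℕ) :
    Ring.choose a n = (descPochhammer ℝ n).eval a / (n.factorial : ℝ) := by
  rw [Ring.choose_eq_smul, Polynomial.descPochhammer_smeval_eq_ascPochhammer,
    Polynomial.ascPochhammer_smeval_eq_eval, ← descPochhammer_eval_eq_ascPochhammer, smul_eq_mul]
  rw [div_eq_inv_mul]

/-- `Ring.choose a 0 = 1`. [folklore] -/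
theorem ring_choose_zero (a : ℝ) : Ring.choose a 0 = 1 := by
  rw [ring_choose_eq_descPochhammer_div]
  simp

/-- The ratio recurrence `C(a, n+1) = C(a, n)·(a-n)/(n+1)`. [folklore] -/
theorem ring_choose_succ (a : ℝ) (n : ℕ) :
    Ring.choose a (n + 1) = Ring.choose a n * (a - n) / ((n : ℝ) + 1) := by
  rw [ring_choose_eq_descPochhammer_div, ring_choose_eq_descPochhammer_div, descPochhammer_succ_eval,
    Nat.factorial_succ]
  have h1 : ((n.factorial : ℕ) : ℝ) ≠ 0 := Nat.cast_ne_zero.mpr (Nat.factorial_ne_zero n)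
  push_cast
  field_simp

/-- The majorant coefficients `m_n(β) := (-1)^n C(-|β|, n) = |β|(|β|+1)⋯(|β|+n-1)/n!` satisfy the
recurrence `m_{n+1} = m_n (|β|+n)/(n+1)`. [folklore] -/
theorem neg_one_pow_mul_ring_choose_neg_succ (b : ℝ) (n : ℕ) :
    (-1 : ℝ) ^ (n + 1) * Ring.choose (-b) (n + 1) =
      ((-1 : ℝ) ^ n * Ring.choose (-b) n) * (b + n) / ((n : ℝ) + 1) := by
  rw [ring_choose_succ, pow_succ]
  have h2 : ((n : ℝ) + 1) ≠ 0 := by positivity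
  field_simp
  ring

/-- `m_n(β) = (-1)^n C(-b, n) ≥ 0` for `b ≥ 0`. [folklore] -/
theorem neg_one_pow_mul_ring_choose_neg_nonneg {b : ℝ} (hb : 0 ≤ b) (n : ℕ) :
    0 ≤ (-1 : ℝ) ^ n * Ring.choose (-b) n := by
  induction n with
  | zero => simp
  | succ n ih =>
    rw [neg_one_pow_mul_ring_choose_neg_succ]
    have : (0 : ℝ) ≤ b + n := by positivity
    positivity

/-- **Termwise majorant** `|C(β, n)| ≤ (-1)^n C(-|β|, n)` (`|β - i| ≤ |β| + i` factor by factor).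
[folklore] -/
theorem abs_ring_choose_le (β : ℝ) (n : ℕ) :
    |Ring.choose β n| ≤ (-1 : ℝ) ^ n * Ring.choose (-|β|) n := by
  induction n with
  | zero => simp
  | succ n ih =>
    rw [ring_choose_succ, neg_one_pow_mul_ring_choose_neg_succ, abs_div, abs_mul,
      abs_of_pos (by positivity : (0 : ℝ) < (n : ℝ) + 1)]
    have h1 : |β - (n : ℝ)| ≤ |β| + n := by
      calc |β - (n : ℝ)| ≤ |β| + |(n : ℝ)| := abs_sub _ _
        _ = |β| + n := by rw [Nat.abs_cast]
    have h2 : 0 ≤ (-1 : ℝ) ^ n * Ring.choose (-|β|) n :=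
      neg_one_pow_mul_ring_choose_neg_nonneg (abs_nonneg β) n
    exact div_le_div_of_nonneg_right (mul_le_mul ih h1 (abs_nonneg _) h2) (by positivity)

/-- Membership of a real number of absolute value `< 1` in the unit `eball`. [folklore] -/
theorem mem_eball_zero_one_of_abs_lt {y : ℝ} (hy : |y| < 1) : y ∈ Metric.eball (0 : ℝ) 1 := by
  rw [Metric.mem_eball, edist_zero_right, ← ofReal_norm, Real.norm_eq_abs]
  exact ENNReal.ofReal_lt_one.mpr hy

/-- **The real binomial series** `Σ_n C(a,n) y^n = (1+y)^a` for `|y| < 1` (Mathlib's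
`Real.one_add_rpow_hasFPowerSeriesOnBall_zero`, scalar form). [folklore] -/
theorem hasSum_ring_choose_mul_pow (a : ℝ) {y : ℝ} (hy : |y| < 1) :
    HasSum (fun n : ℕ => Ring.choose a n * y ^ n) ((1 + y) ^ a) := by
  have h := (Real.one_add_rpow_hasFPowerSeriesOnBall_zero (a := a)).hasSum
    (mem_eball_zero_one_of_abs_lt hy)
  simp only [zero_add] at h
  refine h.congr_fun fun n => ?_
  rw [binomialSeries_apply, List.prod_ofFn, Fin.prod_const, smul_eq_mul]

/-- Absolute convergence of the real binomial series inside the unit interval. [folklore] -/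
theorem summable_abs_ring_choose_mul_pow (a : ℝ) {y : ℝ} (hy : |y| < 1) :
    Summable (fun n : ℕ => |Ring.choose a n * y ^ n|) := by
  have hmem : y ∈ Metric.eball (0 : ℝ) (binomialSeries ℝ a).radius :=
    Metric.eball_subset_eball binomialSeries_radius_ge_one (mem_eball_zero_one_of_abs_lt hy)
  have h := (binomialSeries ℝ a).summable_norm_apply hmem
  refine h.congr fun n => ?_
  rw [Real.norm_eq_abs, binomialSeries_apply, List.prod_ofFn, Fin.prod_const, smul_eq_mul]

/-- The majorant series: `Σ_n (-1)^n C(-b, n) y^n = (1-y)^{-b}` for `0 ≤ y < 1`. [folklore] -/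
theorem hasSum_majorant {b y : ℝ} (hy0 : 0 ≤ y) (hy1 : y < 1) :
    HasSum (fun n : ℕ => (-1 : ℝ) ^ n * Ring.choose (-b) n * y ^ n) ((1 - y) ^ (-b)) := by
  have hy : |(-y)| < 1 := by rw [abs_neg, abs_of_nonneg hy0]; exact hy1
  have h := hasSum_ring_choose_mul_pow (-b) hy
  rw [← sub_eq_add_neg] at h
  refine h.congr_fun fun n => ?_
  rw [neg_pow y n]
  ring

/-- **Majorant bound**: `Σ_n |C(β,n)| y^n ≤ (1-y)^{-|β|}` for `0 ≤ y < 1`. [folklore] -/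
theorem tsum_abs_ring_choose_mul_pow_le (β : ℝ) {y : ℝ} (hy0 : 0 ≤ y) (hy1 : y < 1) :
    ∑' n : ℕ, |Ring.choose β n| * y ^ n ≤ (1 - y) ^ (-|β|) := by
  have hy : |y| < 1 := by rw [abs_of_nonneg hy0]; exact hy1
  have hs : Summable (fun n : ℕ => |Ring.choose β n| * y ^ n) := by
    refine (summable_abs_ring_choose_mul_pow β hy).congr fun n => ?_
    rw [abs_mul, abs_of_nonneg (pow_nonneg hy0 _)]
  have hm := hasSum_majorant (b := |β|) hy0 hy1
  rw [← hm.tsum_eq]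
  refine hs.tsum_le_tsum (fun n => ?_) hm.summable
  exact mul_le_mul_of_nonneg_right (abs_ring_choose_le β n) (pow_nonneg hy0 _)

/-- The coefficients of `(1-y)^α (1+y)^β`: `E(α,β;t) = Σ_{t₁+t₂=t} (-1)^{t₁} C(α,t₁) C(β,t₂)`. [folklore] -/
noncomputable def binomE (α β : ℝ) (t : ℕ) : ℝ :=
  ∑ kl ∈ antidiagonal t, ((-1 : ℝ) ^ kl.1 * Ring.choose α kl.1) * Ring.choose β kl.2

/-- **The product kernel**: `Σ_t E(α,β;t) y^t = (1-y)^α (1+y)^β` for `0 ≤ y < 1`. [folklore] -/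
theorem hasSum_binomE_mul_pow (α β : ℝ) {y : ℝ} (hy0 : 0 ≤ y) (hy1 : y < 1) :
    HasSum (fun t : ℕ => binomE α β t * y ^ t) ((1 - y) ^ α * (1 + y) ^ β) := by
  have hy : |y| < 1 := by rw [abs_of_nonneg hy0]; exact hy1
  have hyn : |(-y)| < 1 := by rw [abs_neg]; exact hy
  have hfsum : HasSum (fun n : ℕ => ((-1 : ℝ) ^ n * Ring.choose α n) * y ^ n) ((1 - y) ^ α) := by
    have h := hasSum_ring_choose_mul_pow α hyn
    rw [← sub_eq_add_neg] at h
    refine h.congr_fun fun n => ?_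
    rw [neg_pow y n]
    ring
  have hgsum : HasSum (fun n : ℕ => Ring.choose β n * y ^ n) ((1 + y) ^ β) :=
    hasSum_ring_choose_mul_pow β hy
  have hfabs : Summable (fun n : ℕ => ‖((-1 : ℝ) ^ n * Ring.choose α n) * y ^ n‖) := by
    refine (summable_abs_ring_choose_mul_pow α hyn).congr fun n => ?_
    rw [Real.norm_eq_abs, neg_pow y n]
    congr 1
    ring
  have hgabs : Summable (fun n : ℕ => ‖Ring.choose β n * y ^ n‖) := by
    refine (summable_abs_ring_choose_mul_pow β hy).congr fun n => ?_
    rw [Real.norm_eq_abs]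
  have hprod := tsum_mul_tsum_eq_tsum_sum_antidiagonal_of_summable_norm hfabs hgabs
  have hsum := summable_sum_mul_antidiagonal_of_summable_norm' hfabs hfsum.summable hgabs hgsum.summable
  have hterm : ∀ t : ℕ, ∑ kl ∈ antidiagonal t,
      (((-1 : ℝ) ^ kl.1 * Ring.choose α kl.1) * y ^ kl.1) * (Ring.choose β kl.2 * y ^ kl.2) =
        binomE α β t * y ^ t := by
    intro t
    unfold binomE
    rw [sum_mul]
    refine sum_congr rfl fun kl hkl => ?_
    rw [mem_antidiagonal] at hkl
    rw [← hkl, pow_add]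
    ring
  have h1 := hsum.hasSum
  rw [← hprod, hfsum.tsum_eq, hgsum.tsum_eq] at h1
  simpa only [hterm] using h1

/-- **Absolute bound for the product kernel**: `Σ_t |E(α,β;t)| y^t` converges for `0 ≤ y < 1` and is
`≤ (1-y)^{-(|α|+|β|)}`. [folklore] -/
theorem tsum_abs_binomE_mul_pow_le (α β : ℝ) {y : ℝ} (hy0 : 0 ≤ y) (hy1 : y < 1) :
    Summable (fun t : ℕ => |binomE α β t| * y ^ t) ∧
      ∑' t : ℕ, |binomE α β t| * y ^ t ≤ (1 - y) ^ (-(|α| + |β|)) := by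
  have hy : |y| < 1 := by rw [abs_of_nonneg hy0]; exact hy1
  have habs : ∀ t : ℕ, |binomE α β t| * y ^ t ≤
      ∑ kl ∈ antidiagonal t, (|Ring.choose α kl.1| * y ^ kl.1) * (|Ring.choose β kl.2| * y ^ kl.2) := by
    intro t
    unfold binomE
    rw [← abs_of_nonneg (pow_nonneg hy0 t), ← abs_mul, sum_mul]
    refine (abs_sum_le_sum_abs _ _).trans (le_of_eq (sum_congr rfl fun kl hkl => ?_))
    rw [mem_antidiagonal] at hkl
    rw [← hkl, pow_add, abs_mul, abs_mul, abs_mul, abs_mul, abs_pow, abs_neg, abs_one, one_pow,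
      one_mul, abs_of_nonneg (pow_nonneg hy0 kl.1), abs_of_nonneg (pow_nonneg hy0 kl.2)]
    ring
  have hFan : Summable (fun n : ℕ => ‖|Ring.choose α n| * y ^ n‖) := by
    refine (summable_abs_ring_choose_mul_pow α hy).congr fun n => ?_
    rw [Real.norm_eq_abs, abs_mul, abs_mul, abs_abs]
  have hGan : Summable (fun n : ℕ => ‖|Ring.choose β n| * y ^ n‖) := by
    refine (summable_abs_ring_choose_mul_pow β hy).congr fun n => ?_
    rw [Real.norm_eq_abs, abs_mul, abs_mul, abs_abs]
  have hmaj := (summable_norm_sum_mul_antidiagonal_of_summable_norm hFan hGan).of_norm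
  have hS : Summable (fun t : ℕ => |binomE α β t| * y ^ t) :=
    Summable.of_nonneg_of_le (fun t => mul_nonneg (abs_nonneg _) (pow_nonneg hy0 _)) habs hmaj
  refine ⟨hS, ?_⟩
  have h0 : 0 ≤ ∑' n : ℕ, |Ring.choose β n| * y ^ n :=
    tsum_nonneg fun n => mul_nonneg (abs_nonneg _) (pow_nonneg hy0 _)
  have h0' : 0 ≤ (1 - y) ^ (-|α|) := Real.rpow_nonneg (by linarith) _
  have hprod := tsum_mul_tsum_eq_tsum_sum_antidiagonal_of_summable_norm hFan hGan
  have step1 := hS.tsum_le_tsum habs hmaj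
  rw [← hprod] at step1
  have step2 : (∑' n : ℕ, |Ring.choose α n| * y ^ n) * (∑' n : ℕ, |Ring.choose β n| * y ^ n) ≤
      (1 - y) ^ (-|α|) * (1 - y) ^ (-|β|) :=
    mul_le_mul (tsum_abs_ring_choose_mul_pow_le α hy0 hy1)
      (tsum_abs_ring_choose_mul_pow_le β hy0 hy1) h0 h0'
  rw [neg_add, Real.rpow_add (by linarith : (0 : ℝ) < 1 - y)]
  exact step1.trans step2

/-! ### §2. One `z`-monomial at a point `(z(s²), z(u²))` of the `ρ`-square -/

/-- `𝒫_{E,j}(P², Q²) = Σ_{i+k=j} λ_iλ_k P^{E-j+2i} Q^{E-j+2k}` for `P, Q > 0` (real exponents).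
[cite: HogervorstRychkov2013, §3 eq. (3.6)] -/
theorem zMono_sq_sq_eq_sum {P Q : ℝ} (hP : 0 < P) (hQ : 0 < Q) (E : ℝ) (j : ℕ) :
    zMono E j (P ^ 2) (Q ^ 2) = ∑ c ∈ antidiagonal j, legendreLam c.1 * legendreLam c.2 *
      (P ^ (E - (j : ℝ) + 2 * (c.1 : ℝ)) * Q ^ (E - (j : ℝ) + 2 * (c.2 : ℝ))) := by
  have hPQ : 0 < P * Q := mul_pos hP hQ
  have hpow : (P ^ 2 * Q ^ 2) ^ ((E - (j : ℝ)) / 2) = P ^ (E - (j : ℝ)) * Q ^ (E - (j : ℝ)) := by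
    rw [show P ^ 2 * Q ^ 2 = (P * Q) ^ (2 : ℕ) by ring, ← Real.rpow_natCast (P * Q) 2,
      ← Real.rpow_mul hPQ.le, show ((2 : ℕ) : ℝ) * ((E - (j : ℝ)) / 2) = E - (j : ℝ) by push_cast; ring,
      Real.mul_rpow hP.le hQ.le]
  unfold zMono zLegendre
  rw [hpow, mul_sum]
  refine sum_congr rfl fun c _ => ?_
  rw [Real.rpow_add hP, Real.rpow_add hQ,
    show (2 : ℝ) * (c.1 : ℝ) = ((2 * c.1 : ℕ) : ℝ) by push_cast; ring,
    show (2 : ℝ) * (c.2 : ℝ) = ((2 * c.2 : ℕ) : ℝ) by push_cast; ring,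
    Real.rpow_natCast, Real.rpow_natCast, pow_mul, pow_mul]
  ring

/-- The one-dimensional conversion factor: for `s > 0`, `d > 0` (`d = 1 ± s²`) and exponent
`e = γ + a₀` (`γ` real, `a₀ ∈ ℕ`): `(2s/d)^e = 2^e · s^γ · s^{a₀} · d^{-e}`. [folklore] -/
theorem two_mul_div_rpow {s d : ℝ} (hs : 0 < s) (hd : 0 < d) (γ : ℝ) (a₀ : ℕ) :
    (2 * s / d) ^ (γ + (a₀ : ℝ)) = (2 : ℝ) ^ (γ + (a₀ : ℝ)) * s ^ γ * s ^ a₀ * d ^ (-(γ + (a₀ : ℝ))) := by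
  rw [Real.div_rpow (by positivity) hd.le, Real.mul_rpow (by norm_num) hs.le, Real.rpow_add hs,
    Real.rpow_natCast, Real.rpow_neg hd.le, div_eq_mul_inv]
  ring

/-- `1 - z(s²)` raised to `c`: `(1 - z(s²))^c = (1-s²)^{2c} (1+s²)^{-2c}` for `0 < s < 1`.
[cite: CostaHansenPenedonesTrevisani2016, §2 eq. (2.7)] -/
theorem one_sub_zOfRho_sq_rpow {s : ℝ} (hs0 : 0 < s) (hs1 : s < 1) (c : ℝ) :
    (1 - zOfRho (s ^ 2)) ^ c = (1 - s ^ 2) ^ (2 * c) * (1 + s ^ 2) ^ (-(2 * c)) := by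
  have h1 : 0 < 1 - s ^ 2 := by nlinarith
  have h2 : 0 < 1 + s ^ 2 := by positivity
  rw [one_sub_zOfRho_sq, ← Real.rpow_natCast ((1 - s ^ 2) / (1 + s ^ 2)) 2,
    ← Real.rpow_mul (div_pos h1 h2).le, Real.div_rpow h1.le h2.le, Real.rpow_neg h2.le,
    div_eq_mul_inv]
  push_cast
  ring_nf

/-- **One term, one variable**: for `0 < s < 1`, real `γ`, `c` and `a₀ ∈ ℕ`,
`(1 - z(s²))^c · (2s/(1+s²))^{γ+a₀} = 2^{γ+a₀} s^γ · [s^{a₀} (1-s²)^{2c} (1+s²)^{-(γ+a₀)-2c}]`.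
[cite: HogervorstRychkov2013, §3 "first method"] -/
theorem one_sub_zOfRho_rpow_mul_conv {s : ℝ} (hs0 : 0 < s) (hs1 : s < 1) (c γ : ℝ) (a₀ : ℕ) :
    (1 - zOfRho (s ^ 2)) ^ c * (2 * s / (1 + s ^ 2)) ^ (γ + (a₀ : ℝ)) =
      (2 : ℝ) ^ (γ + (a₀ : ℝ)) * s ^ γ *
        (s ^ a₀ * ((1 - s ^ 2) ^ (2 * c) * (1 + s ^ 2) ^ (-(γ + (a₀ : ℝ)) - 2 * c))) := by
  have h2 : 0 < 1 + s ^ 2 := by positivity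
  rw [one_sub_zOfRho_sq_rpow hs0 hs1, two_mul_div_rpow hs0 h2,
    show -(γ + (a₀ : ℝ)) - 2 * c = -(2 * c) + (-(γ + (a₀ : ℝ))) by ring, Real.rpow_add h2]
  ring

/-- **The one-variable conversion series**: for `0 < s < 1`,
`Σ_t E(2c, -(γ+a₀)-2c; t) s^{a₀+2t} = s^{a₀} (1-s²)^{2c} (1+s²)^{-(γ+a₀)-2c}`, absolutely, with
`Σ_t |E(…;t)| s^{a₀+2t} ≤ s^{a₀} (1-s²)^{-(|2c| + |-(γ+a₀)-2c|)}`. [cite: HogervorstRychkov2013, §3 "first method"] -/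
theorem hasSum_conv1 {s : ℝ} (hs0 : 0 < s) (hs1 : s < 1) (c γ : ℝ) (a₀ : ℕ) :
    HasSum (fun t : ℕ => binomE (2 * c) (-(γ + (a₀ : ℝ)) - 2 * c) t * s ^ (a₀ + 2 * t))
        (s ^ a₀ * ((1 - s ^ 2) ^ (2 * c) * (1 + s ^ 2) ^ (-(γ + (a₀ : ℝ)) - 2 * c))) ∧
      Summable (fun t : ℕ => |binomE (2 * c) (-(γ + (a₀ : ℝ)) - 2 * c) t| * s ^ (a₀ + 2 * t)) ∧
        ∑' t : ℕ, |binomE (2 * c) (-(γ + (a₀ : ℝ)) - 2 * c) t| * s ^ (a₀ + 2 * t) ≤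
          s ^ a₀ * (1 - s ^ 2) ^ (-(|2 * c| + |-(γ + (a₀ : ℝ)) - 2 * c|)) := by
  have hy0 : 0 ≤ s ^ 2 := sq_nonneg s
  have hy1 : s ^ 2 < 1 := by nlinarith
  have hpow : ∀ t : ℕ, s ^ (a₀ + 2 * t) = s ^ a₀ * (s ^ 2) ^ t := fun t => by
    rw [pow_add, pow_mul]
  refine ⟨?_, ?_, ?_⟩
  · have h := (hasSum_binomE_mul_pow (2 * c) (-(γ + (a₀ : ℝ)) - 2 * c) hy0 hy1).mul_left (s ^ a₀)
    refine h.congr_fun fun t => ?_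
    rw [hpow]
    ring
  · have h := (tsum_abs_binomE_mul_pow_le (2 * c) (-(γ + (a₀ : ℝ)) - 2 * c) hy0 hy1).1.mul_left (s ^ a₀)
    refine h.congr fun t => ?_
    rw [hpow]
    ring
  · obtain ⟨hS, hle⟩ := tsum_abs_binomE_mul_pow_le (2 * c) (-(γ + (a₀ : ℝ)) - 2 * c) hy0 hy1
    have hfun : (fun t : ℕ => |binomE (2 * c) (-(γ + (a₀ : ℝ)) - 2 * c) t| * s ^ (a₀ + 2 * t)) =
        fun t : ℕ => s ^ a₀ * (|binomE (2 * c) (-(γ + (a₀ : ℝ)) - 2 * c) t| * (s ^ 2) ^ t) := by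
      funext t
      rw [hpow]
      ring
    rw [hfun, tsum_mul_left]
    exact mul_le_mul_of_nonneg_left hle (pow_nonneg hs0.le _)

/-! ### §3. The two-variable product kernel -/

/-- Product of two absolutely convergent real series over `ℕ` as a double series over `ℕ × ℕ`:
sum, absolute summability, and the product bound for the absolute series. [folklore] -/
theorem hasSum_prod_of_abs {f g : ℕ → ℝ} {a b Bf Bg : ℝ} (hf : HasSum f a) (hg : HasSum g b)
    (hfa : Summable (fun n => |f n|)) (hga : Summable (fun n => |g n|))
    (hBf : ∑' n, |f n| ≤ Bf) (hBg : ∑' n, |g n| ≤ Bg) :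
    HasSum (fun tt : ℕ × ℕ => f tt.1 * g tt.2) (a * b) ∧
      Summable (fun tt : ℕ × ℕ => |f tt.1 * g tt.2|) ∧
        ∑' tt : ℕ × ℕ, |f tt.1 * g tt.2| ≤ Bf * Bg := by
  have hfn : Summable (fun n => ‖f n‖) := hfa.congr fun n => (Real.norm_eq_abs _).symm
  have hgn : Summable (fun n => ‖g n‖) := hga.congr fun n => (Real.norm_eq_abs _).symm
  have hprod : Summable (fun tt : ℕ × ℕ => f tt.1 * g tt.2) := summable_mul_of_summable_norm hfn hgn
  refine ⟨hf.mul hg hprod, ?_, ?_⟩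
  · have hfan : Summable (fun n => ‖|f n|‖) := hfa.congr fun n => by rw [Real.norm_eq_abs, abs_abs]
    have hgan : Summable (fun n => ‖|g n|‖) := hga.congr fun n => by rw [Real.norm_eq_abs, abs_abs]
    exact (summable_mul_of_summable_norm hfan hgan).congr fun tt => (abs_mul _ _).symm
  · have hfan : Summable (fun n => ‖|f n|‖) := hfa.congr fun n => by rw [Real.norm_eq_abs, abs_abs]
    have hgan : Summable (fun n => ‖|g n|‖) := hga.congr fun n => by rw [Real.norm_eq_abs, abs_abs]
    have heq := tsum_mul_tsum_of_summable_norm hfan hgan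
    have hfun : (fun z : ℕ × ℕ => |f z.1| * |g z.2|) = fun z : ℕ × ℕ => |f z.1 * g z.2| := by
      funext z; rw [abs_mul]
    rw [hfun] at heq
    rw [← heq]
    have h0 : 0 ≤ ∑' n, |g n| := tsum_nonneg fun n => abs_nonneg _
    have h0' : 0 ≤ Bf := (tsum_nonneg fun n => abs_nonneg (f n)).trans hBf
    exact mul_le_mul hBf hBg h0 h0'

/-! ### §4. The conversion coefficients and the per-term conversion series -/

/-- The `(s,u)`-offset `a₀ = ℓ + n - j + 2i` of the `i`-th Legendre component of the `z`-monomial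
`𝒫_{Δ+n,j}` after conversion (`j ≤ ℓ + n` on the descendant range). [folklore] -/
def convOffset (ℓ n j i : ℕ) : ℕ := ℓ + n - j + 2 * i

/-- The conversion index: `τ = ((n,j), ((i,k), (t,t')))` — `z`-level and spin, Legendre split
`i + k = j`, binomial orders `t, t'` in the two variables. [folklore] -/
abbrev ConvIndex : Type := (ℕ × ℕ) × ((ℕ × ℕ) × (ℕ × ℕ))

/-- **The conversion coefficient** attached to `τ = ((n,j),((i,k),(t,t')))`:
`A_{n,j} · 4^n · λ_iλ_k · E(2c, -(γ+a₀)-2c; t) · E(2c, -(γ+b₀)-2c; t')`, `γ = Δ - ℓ`,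
`a₀ = ℓ+n-j+2i`, `b₀ = ℓ+n-j+2k` (zero unless `i + k = j`). Its `(s,u)`-degree is
`(a₀ + 2t, b₀ + 2t')` (`convDeg`). Independent of the point. (Hogervorst–Rychkov 2013 §3, "first
method": substitute `z = 4ρ/(1+ρ)²` and expand the denominators.) [cite: HogervorstRychkov2013, §3 "first method"] -/
noncomputable def convCoeff (c Δ : ℝ) (ℓ : ℕ) (A : ℕ × ℕ → ℝ) (τ : ConvIndex) : ℝ :=
  if τ.2.1.1 + τ.2.1.2 = τ.1.2 then
    A τ.1 * (4 : ℝ) ^ τ.1.1 * (legendreLam τ.2.1.1 * legendreLam τ.2.1.2) *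
      (binomE (2 * c) (-((Δ - (ℓ : ℝ)) + (convOffset ℓ τ.1.1 τ.1.2 τ.2.1.1 : ℝ)) - 2 * c) τ.2.2.1 *
        binomE (2 * c) (-((Δ - (ℓ : ℝ)) + (convOffset ℓ τ.1.1 τ.1.2 τ.2.1.2 : ℝ)) - 2 * c) τ.2.2.2)
  else 0

/-- The `(s,u)`-degree of the conversion index `τ`: `(a₀ + 2t, b₀ + 2t')`. [folklore] -/
def convDeg (ℓ : ℕ) (τ : ConvIndex) : ℕ × ℕ :=
  (convOffset ℓ τ.1.1 τ.1.2 τ.2.1.1 + 2 * τ.2.2.1, convOffset ℓ τ.1.1 τ.1.2 τ.2.1.2 + 2 * τ.2.2.2)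

/-- The conversion term at the point `(s,u)`: coefficient times `s^a u^b`, `(a,b) = convDeg τ`.
[folklore] -/
noncomputable def convTerm (c Δ : ℝ) (ℓ : ℕ) (A : ℕ × ℕ → ℝ) (s u : ℝ) (τ : ConvIndex) : ℝ :=
  convCoeff c Δ ℓ A τ * (s ^ (convDeg ℓ τ).1 * u ^ (convDeg ℓ τ).2)

/-- **The `z → ρ` conversion array** (in the square-root coordinates): the coefficient of `s^a u^b` is
the sum of the conversion coefficients over the fibre `convDeg = (a,b)` (a finitely supported sum).
[cite: HogervorstRychkov2013, §3 "first method"] -/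
noncomputable def zRhoConv (c Δ : ℝ) (ℓ : ℕ) (A : ℕ × ℕ → ℝ) (p : ℕ × ℕ) : ℝ :=
  ∑' τ : ↥(convDeg ℓ ⁻¹' {p}), convCoeff c Δ ℓ A (τ : ConvIndex)

/-- The exponent identity `Δ + n - j + 2i = (Δ - ℓ) + a₀` on the descendant range. [folklore] -/
theorem convOffset_cast {ℓ n j : ℕ} (hj : j ≤ ℓ + n) (Δ : ℝ) (i : ℕ) :
    Δ + (n : ℝ) - (j : ℝ) + 2 * (i : ℝ) = (Δ - (ℓ : ℝ)) + (convOffset ℓ n j i : ℝ) := by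
  unfold convOffset
  push_cast [Nat.cast_sub hj]
  ring

/-- `2^{γ+a₀} · 2^{γ+b₀} = 4^Δ · 4^n` when `(γ+a₀)+(γ+b₀) = 2(Δ+n)`, i.e. on the Legendre split
`i + k = j` of the descendant range. [folklore] -/
theorem two_rpow_mul_two_rpow {ℓ n j i k : ℕ} (hj : j ≤ ℓ + n) (hik : i + k = j) (Δ : ℝ) :
    (2 : ℝ) ^ ((Δ - (ℓ : ℝ)) + (convOffset ℓ n j i : ℝ)) *
        (2 : ℝ) ^ ((Δ - (ℓ : ℝ)) + (convOffset ℓ n j k : ℝ)) = (4 : ℝ) ^ Δ * (4 : ℝ) ^ n := by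
  have hsum : ((Δ - (ℓ : ℝ)) + (convOffset ℓ n j i : ℝ)) + ((Δ - (ℓ : ℝ)) + (convOffset ℓ n j k : ℝ)) =
      2 * (Δ + (n : ℝ)) := by
    unfold convOffset
    push_cast [Nat.cast_sub hj]
    have : (i : ℝ) + (k : ℝ) = (j : ℝ) := by exact_mod_cast hik
    linarith
  rw [← Real.rpow_add two_pos, hsum, Real.rpow_mul (by norm_num : (0 : ℝ) ≤ 2),
    show (2 : ℝ) ^ (2 : ℝ) = 4 by norm_num, Real.rpow_add (by norm_num : (0 : ℝ) < 4),
    Real.rpow_natCast]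

/-- **Resummation of the Legendre split** (the common algebra of the value and of the bound): for
`s, u, d_s, d_u > 0`, `γ = Δ - ℓ`, `j ≤ ℓ + n` and any constant `K`,
`Σ_{i+k=j} K·4^n·λ_iλ_k·(s^{a₀} d_s^{-(γ+a₀)})(u^{b₀} d_u^{-(γ+b₀)}) = (su)^{-γ} 4^{-Δ} K 𝒫_{Δ+n,j}((2s/d_s)², (2u/d_u)²)`.
[cite: HogervorstRychkov2013, §3 "first method"] -/
theorem sum_conv_eq {s u ds du : ℝ} (hs : 0 < s) (hu : 0 < u) (hds : 0 < ds) (hdu : 0 < du)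
    (Δ K : ℝ) {ℓ n j : ℕ} (hj : j ≤ ℓ + n) :
    ∑ c' ∈ antidiagonal j, K * (4 : ℝ) ^ n * (legendreLam c'.1 * legendreLam c'.2) *
        ((s ^ convOffset ℓ n j c'.1 * ds ^ (-((Δ - (ℓ : ℝ)) + (convOffset ℓ n j c'.1 : ℝ)))) *
          (u ^ convOffset ℓ n j c'.2 * du ^ (-((Δ - (ℓ : ℝ)) + (convOffset ℓ n j c'.2 : ℝ))))) =
      (s * u) ^ (-(Δ - (ℓ : ℝ))) * (4 : ℝ) ^ (-Δ) *
        (K * zMono (Δ + (n : ℝ)) j ((2 * s / ds) ^ 2) ((2 * u / du) ^ 2)) := by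
  have hPs : 0 < 2 * s / ds := by positivity
  have hPu : 0 < 2 * u / du := by positivity
  rw [zMono_sq_sq_eq_sum hPs hPu, mul_sum, mul_sum]
  refine sum_congr rfl fun c' hc' => ?_
  rw [mem_antidiagonal] at hc'
  rw [convOffset_cast hj Δ c'.1, convOffset_cast hj Δ c'.2, two_mul_div_rpow hs hds, two_mul_div_rpow hu hdu]
  have h4 := two_rpow_mul_two_rpow hj hc' Δ
  have hsu : (s * u) ^ (-(Δ - (ℓ : ℝ))) * (s ^ (Δ - (ℓ : ℝ)) * u ^ (Δ - (ℓ : ℝ))) = 1 := by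
    rw [← Real.mul_rpow hs.le hu.le, Real.rpow_neg (mul_pos hs hu).le,
      inv_mul_cancel₀ (Real.rpow_pos_of_pos (mul_pos hs hu) _).ne']
  have h44 : (4 : ℝ) ^ (-Δ) * (4 : ℝ) ^ Δ = 1 := by
    rw [Real.rpow_neg (by norm_num : (0 : ℝ) ≤ 4),
      inv_mul_cancel₀ (Real.rpow_pos_of_pos (by norm_num : (0 : ℝ) < 4) _).ne']
  -- normalise both sides to the same monomial
  set γ := Δ - (ℓ : ℝ) with hγ
  set a := (convOffset ℓ n j c'.1 : ℝ)
  set b := (convOffset ℓ n j c'.2 : ℝ)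
  rw [show (2 : ℝ) ^ (γ + a) * s ^ γ * s ^ convOffset ℓ n j c'.1 * ds ^ (-(γ + a)) *
      ((2 : ℝ) ^ (γ + b) * u ^ γ * u ^ convOffset ℓ n j c'.2 * du ^ (-(γ + b))) =
      ((2 : ℝ) ^ (γ + a) * (2 : ℝ) ^ (γ + b)) * ((s ^ γ * u ^ γ) *
        ((s ^ convOffset ℓ n j c'.1 * ds ^ (-(γ + a))) * (u ^ convOffset ℓ n j c'.2 * du ^ (-(γ + b)))))
      by ring, h4]
  calc K * (4 : ℝ) ^ n * (legendreLam c'.1 * legendreLam c'.2) *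
        ((s ^ convOffset ℓ n j c'.1 * ds ^ (-(γ + a))) * (u ^ convOffset ℓ n j c'.2 * du ^ (-(γ + b))))
      = ((s * u) ^ (-γ) * (s ^ γ * u ^ γ)) * ((4 : ℝ) ^ (-Δ) * (4 : ℝ) ^ Δ) *
          (K * (4 : ℝ) ^ n * (legendreLam c'.1 * legendreLam c'.2) *
            ((s ^ convOffset ℓ n j c'.1 * ds ^ (-(γ + a))) *
              (u ^ convOffset ℓ n j c'.2 * du ^ (-(γ + b))))) := by rw [hsu, h44]; ring
    _ = _ := by ring

/-- **Assembling a double family from its rows** (real-valued, product index): if every row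
`c ↦ U(b,c)` has sum `r b` and absolutely summable with `Σ' |U(b,·)| ≤ B b`, and `Σ B` and `Σ r`
converge, then `U` has sum `Σ r`, is absolutely summable, and `Σ' |U| ≤ Σ B`. [folklore] -/
theorem hasSum_prod_assemble {β γ : Type*} {U : β × γ → ℝ} {r B : β → ℝ} {S T : ℝ}
    (hrow : ∀ b, HasSum (fun c => U (b, c)) (r b)) (habs : ∀ b, Summable (fun c => |U (b, c)|))
    (hB : ∀ b, ∑' c, |U (b, c)| ≤ B b) (hBs : HasSum B T) (hr : HasSum r S) :
    HasSum U S ∧ Summable (fun x => |U x|) ∧ ∑' x, |U x| ≤ T := by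
  have hA : Summable (fun x : β × γ => |U x|) := by
    refine (summable_prod_of_nonneg (fun x => abs_nonneg _)).mpr ⟨habs, ?_⟩
    exact Summable.of_nonneg_of_le (fun b => tsum_nonneg fun c => abs_nonneg _) hB hBs.summable
  have hU : Summable U := (summable_abs_iff).mp hA
  have h1 : HasSum r (∑' x, U x) := hU.hasSum.prod_fiberwise hrow
  have h2 : HasSum (fun b => ∑' c, |U (b, c)|) (∑' x, |U x|) :=
    hA.hasSum.prod_fiberwise fun b => (habs b).hasSum
  refine ⟨?_, hA, ?_⟩
  · rw [← h1.unique hr]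
    exact hU.hasSum
  · rw [← h2.tsum_eq, ← hBs.tsum_eq]
    exact h2.summable.tsum_le_tsum hB hBs.summable

/-- The conversion term unfolded at `τ = (q, (c', tt))`. [folklore] -/
theorem convTerm_apply (c Δ : ℝ) (ℓ : ℕ) (A : ℕ × ℕ → ℝ) (s u : ℝ) (q c' tt : ℕ × ℕ) :
    convTerm c Δ ℓ A s u (q, (c', tt)) =
      if c'.1 + c'.2 = q.2 then
        (A q * (4 : ℝ) ^ q.1 * (legendreLam c'.1 * legendreLam c'.2)) *
          ((binomE (2 * c) (-((Δ - (ℓ : ℝ)) + (convOffset ℓ q.1 q.2 c'.1 : ℝ)) - 2 * c) tt.1 *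
              s ^ (convOffset ℓ q.1 q.2 c'.1 + 2 * tt.1)) *
            (binomE (2 * c) (-((Δ - (ℓ : ℝ)) + (convOffset ℓ q.1 q.2 c'.2 : ℝ)) - 2 * c) tt.2 *
              u ^ (convOffset ℓ q.1 q.2 c'.2 + 2 * tt.2)))
      else 0 := by
  unfold convTerm convCoeff convDeg
  simp only
  split_ifs
  · ring
  · rw [zero_mul]

/-- **The conversion series of one `z`-monomial.** For `0 < s, u < 1`, `ℓ ≤ Δ`, `A ≥ 0` and a
descendant index `q = (n,j)`, `j ≤ ℓ + n`: the family `σ ↦ convTerm (q, σ)` has sum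
`(su)^{-(Δ-ℓ)} 4^{-Δ} · A_q ((1-z(s²))(1-z(u²)))^c 𝒫_{Δ+n,j}(z(s²), z(u²))`, is absolutely summable, and
its absolute sum is at most `(su)^{-(Δ-ℓ)} 4^{-Δ} ((1-s²)(1-u²))^{-4|c|} A_q 𝒫_{Δ+n,j}((2s/(1-s²))², (2u/(1-u²))²)`.
[cite: HogervorstRychkov2013, §3 "first method"] -/
theorem hasSum_convTerm_level {c Δ : ℝ} {ℓ : ℕ} {A : ℕ × ℕ → ℝ} (hA0 : ∀ q, 0 ≤ A q)
    (hΔ : (ℓ : ℝ) ≤ Δ) {s u : ℝ} (hs0 : 0 < s) (hs1 : s < 1) (hu0 : 0 < u) (hu1 : u < 1)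
    (q : ℕ × ℕ) (hq : q.2 ≤ ℓ + q.1) :
    HasSum (fun σ : (ℕ × ℕ) × (ℕ × ℕ) => convTerm c Δ ℓ A s u (q, σ))
        ((s * u) ^ (-(Δ - (ℓ : ℝ))) * (4 : ℝ) ^ (-Δ) *
          (A q * ((1 - zOfRho (s ^ 2)) ^ c * (1 - zOfRho (u ^ 2)) ^ c *
            zMono (Δ + (q.1 : ℝ)) q.2 (zOfRho (s ^ 2)) (zOfRho (u ^ 2))))) ∧
      Summable (fun σ : (ℕ × ℕ) × (ℕ × ℕ) => |convTerm c Δ ℓ A s u (q, σ)|) ∧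
        ∑' σ : (ℕ × ℕ) × (ℕ × ℕ), |convTerm c Δ ℓ A s u (q, σ)| ≤
          (s * u) ^ (-(Δ - (ℓ : ℝ))) * (4 : ℝ) ^ (-Δ) *
            (((1 - s ^ 2) ^ (-(4 * |c|)) * (1 - u ^ 2) ^ (-(4 * |c|))) *
              (A q * zMono (Δ + (q.1 : ℝ)) q.2 ((2 * s / (1 - s ^ 2)) ^ 2) ((2 * u / (1 - u ^ 2)) ^ 2))) := by
  classical
  obtain ⟨n, j⟩ := q
  simp only at hq ⊢
  set γ : ℝ := Δ - (ℓ : ℝ) with hγ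
  have hγ0 : 0 ≤ γ := by rw [hγ]; linarith
  have h1s : 0 < 1 - s ^ 2 := by nlinarith
  have h1u : 0 < 1 - u ^ 2 := by nlinarith
  have h1s' : 0 < 1 + s ^ 2 := by positivity
  have h1u' : 0 < 1 + u ^ 2 := by positivity
  -- notation for the rows
  set K : ℕ × ℕ → ℝ := fun c' => A (n, j) * (4 : ℝ) ^ n * (legendreLam c'.1 * legendreLam c'.2) with hK
  have hK0 : ∀ c', 0 ≤ K c' := fun c' =>
    mul_nonneg (mul_nonneg (hA0 _) (pow_nonneg (by norm_num) _))
      (mul_nonneg (legendreLam_pos _).le (legendreLam_pos _).le)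
  -- value and bound of the rows
  set Fs : ℕ → ℝ := fun i => s ^ convOffset ℓ n j i *
    ((1 - s ^ 2) ^ (2 * c) * (1 + s ^ 2) ^ (-(γ + (convOffset ℓ n j i : ℝ)) - 2 * c)) with hFs
  set Gu : ℕ → ℝ := fun k => u ^ convOffset ℓ n j k *
    ((1 - u ^ 2) ^ (2 * c) * (1 + u ^ 2) ^ (-(γ + (convOffset ℓ n j k : ℝ)) - 2 * c)) with hGu
  set Bs : ℕ → ℝ := fun i => s ^ convOffset ℓ n j i *
    (1 - s ^ 2) ^ (-(|2 * c| + |-(γ + (convOffset ℓ n j i : ℝ)) - 2 * c|)) with hBs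
  set Bu : ℕ → ℝ := fun k => u ^ convOffset ℓ n j k *
    (1 - u ^ 2) ^ (-(|2 * c| + |-(γ + (convOffset ℓ n j k : ℝ)) - 2 * c|)) with hBu
  have hrow : ∀ c' : ℕ × ℕ, c'.1 + c'.2 = j →
      HasSum (fun tt : ℕ × ℕ => convTerm c Δ ℓ A s u ((n, j), (c', tt))) (K c' * (Fs c'.1 * Gu c'.2)) ∧
        Summable (fun tt : ℕ × ℕ => |convTerm c Δ ℓ A s u ((n, j), (c', tt))|) ∧
          ∑' tt : ℕ × ℕ, |convTerm c Δ ℓ A s u ((n, j), (c', tt))| ≤ K c' * (Bs c'.1 * Bu c'.2) := by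
    intro c' hc'
    obtain ⟨hf, hfa, hfb⟩ := hasSum_conv1 hs0 hs1 c γ (convOffset ℓ n j c'.1)
    obtain ⟨hg, hga, hgb⟩ := hasSum_conv1 hu0 hu1 c γ (convOffset ℓ n j c'.2)
    have hfa' := hfa.congr fun t => by rw [← abs_of_nonneg (pow_nonneg hs0.le _), ← abs_mul]
    have hga' := hga.congr fun t => by rw [← abs_of_nonneg (pow_nonneg hu0.le _), ← abs_mul]
    have hfb' : ∑' t : ℕ, |binomE (2 * c) (-(γ + (convOffset ℓ n j c'.1 : ℝ)) - 2 * c) t *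
        s ^ (convOffset ℓ n j c'.1 + 2 * t)| ≤ Bs c'.1 := by
      refine le_of_eq_of_le (tsum_congr fun t => ?_) hfb
      rw [abs_mul, abs_of_nonneg (pow_nonneg hs0.le _)]
    have hgb' : ∑' t : ℕ, |binomE (2 * c) (-(γ + (convOffset ℓ n j c'.2 : ℝ)) - 2 * c) t *
        u ^ (convOffset ℓ n j c'.2 + 2 * t)| ≤ Bu c'.2 := by
      refine le_of_eq_of_le (tsum_congr fun t => ?_) hgb
      rw [abs_mul, abs_of_nonneg (pow_nonneg hu0.le _)]
    obtain ⟨hp, hpa, hpb⟩ := hasSum_prod_of_abs hf hg hfa' hga' hfb' hgb'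
    have hterm : ∀ tt : ℕ × ℕ, convTerm c Δ ℓ A s u ((n, j), (c', tt)) = K c' *
        ((binomE (2 * c) (-(γ + (convOffset ℓ n j c'.1 : ℝ)) - 2 * c) tt.1 *
            s ^ (convOffset ℓ n j c'.1 + 2 * tt.1)) *
          (binomE (2 * c) (-(γ + (convOffset ℓ n j c'.2 : ℝ)) - 2 * c) tt.2 *
            u ^ (convOffset ℓ n j c'.2 + 2 * tt.2))) := by
      intro tt
      rw [convTerm_apply, if_pos hc']
    refine ⟨?_, ?_, ?_⟩
    · simpa only [hterm] using hp.mul_left (K c')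
    · refine (hpa.mul_left (K c')).congr fun tt => ?_
      rw [hterm, abs_mul (K c'), abs_of_nonneg (hK0 c')]
    · have heq : (fun tt : ℕ × ℕ => |convTerm c Δ ℓ A s u ((n, j), (c', tt))|) =
          fun tt : ℕ × ℕ => K c' * |(binomE (2 * c) (-(γ + (convOffset ℓ n j c'.1 : ℝ)) - 2 * c) tt.1 *
            s ^ (convOffset ℓ n j c'.1 + 2 * tt.1)) *
          (binomE (2 * c) (-(γ + (convOffset ℓ n j c'.2 : ℝ)) - 2 * c) tt.2 *
            u ^ (convOffset ℓ n j c'.2 + 2 * tt.2))| := by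
        funext tt
        rw [hterm, abs_mul (K c'), abs_of_nonneg (hK0 c')]
      rw [heq, tsum_mul_left]
      exact mul_le_mul_of_nonneg_left hpb (hK0 c')
  -- rows off the Legendre split vanish
  have hoff : ∀ c' : ℕ × ℕ, c'.1 + c'.2 ≠ j →
      (fun tt : ℕ × ℕ => convTerm c Δ ℓ A s u ((n, j), (c', tt))) = fun _ => 0 := by
    intro c' hc'
    funext tt
    rw [convTerm_apply, if_neg hc']
  have hoffa : ∀ c' : ℕ × ℕ, c'.1 + c'.2 ≠ j →
      (fun tt : ℕ × ℕ => |convTerm c Δ ℓ A s u ((n, j), (c', tt))|) = fun _ => 0 := by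
    intro c' hc'
    funext tt
    rw [convTerm_apply, if_neg hc', abs_zero]
  -- assemble
  obtain ⟨hS, hA, hT⟩ := hasSum_prod_assemble (U := fun x : (ℕ × ℕ) × (ℕ × ℕ) =>
      convTerm c Δ ℓ A s u ((n, j), x))
    (r := fun c' => if c'.1 + c'.2 = j then K c' * (Fs c'.1 * Gu c'.2) else 0)
    (B := fun c' => if c'.1 + c'.2 = j then K c' * (Bs c'.1 * Bu c'.2) else 0)
    (S := ∑ c' ∈ antidiagonal j, K c' * (Fs c'.1 * Gu c'.2))
    (T := ∑ c' ∈ antidiagonal j, K c' * (Bs c'.1 * Bu c'.2))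
    (fun c' => by
      by_cases hc' : c'.1 + c'.2 = j
      · rw [if_pos hc']; exact (hrow c' hc').1
      · rw [if_neg hc', hoff c' hc']; exact hasSum_zero)
    (fun c' => by
      by_cases hc' : c'.1 + c'.2 = j
      · exact (hrow c' hc').2.1
      · rw [hoffa c' hc']; exact summable_zero)
    (fun c' => by
      by_cases hc' : c'.1 + c'.2 = j
      · rw [if_pos hc']; exact (hrow c' hc').2.2
      · rw [if_neg hc', hoffa c' hc', tsum_zero])
    (by
      have hs : ∑ c' ∈ antidiagonal j, K c' * (Bs c'.1 * Bu c'.2) =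
          ∑ c' ∈ antidiagonal j, (if c'.1 + c'.2 = j then K c' * (Bs c'.1 * Bu c'.2) else 0) :=
        Finset.sum_congr rfl fun c' hc' => by rw [mem_antidiagonal] at hc'; rw [if_pos hc']
      rw [hs]
      exact hasSum_sum_of_ne_finset_zero fun c' hc' => by
        rw [mem_antidiagonal] at hc'; rw [if_neg hc'])
    (by
      have hs : ∑ c' ∈ antidiagonal j, K c' * (Fs c'.1 * Gu c'.2) =
          ∑ c' ∈ antidiagonal j, (if c'.1 + c'.2 = j then K c' * (Fs c'.1 * Gu c'.2) else 0) :=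
        Finset.sum_congr rfl fun c' hc' => by rw [mem_antidiagonal] at hc'; rw [if_pos hc']
      rw [hs]
      exact hasSum_sum_of_ne_finset_zero fun c' hc' => by
        rw [mem_antidiagonal] at hc'; rw [if_neg hc'])
  -- identify the value
  have hX : zOfRho (s ^ 2) = (2 * s / (1 + s ^ 2)) ^ 2 := zOfRho_sq s
  have hY : zOfRho (u ^ 2) = (2 * u / (1 + u ^ 2)) ^ 2 := zOfRho_sq u
  have hval : ∑ c' ∈ antidiagonal j, K c' * (Fs c'.1 * Gu c'.2) =
      (s * u) ^ (-γ) * (4 : ℝ) ^ (-Δ) * (A (n, j) * ((1 - zOfRho (s ^ 2)) ^ c *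
        (1 - zOfRho (u ^ 2)) ^ c * zMono (Δ + (n : ℝ)) j (zOfRho (s ^ 2)) (zOfRho (u ^ 2)))) := by
    have hsplit : ∀ c' : ℕ × ℕ, K c' * (Fs c'.1 * Gu c'.2) =
        ((1 - zOfRho (s ^ 2)) ^ c * (1 - zOfRho (u ^ 2)) ^ c) *
          (A (n, j) * (4 : ℝ) ^ n * (legendreLam c'.1 * legendreLam c'.2) *
            ((s ^ convOffset ℓ n j c'.1 * (1 + s ^ 2) ^ (-(γ + (convOffset ℓ n j c'.1 : ℝ)))) *
              (u ^ convOffset ℓ n j c'.2 * (1 + u ^ 2) ^ (-(γ + (convOffset ℓ n j c'.2 : ℝ)))))) := by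
      intro c'
      rw [hK, hFs, hGu, one_sub_zOfRho_sq_rpow hs0 hs1, one_sub_zOfRho_sq_rpow hu0 hu1]
      simp only
      rw [show -(γ + (convOffset ℓ n j c'.1 : ℝ)) - 2 * c = -(2 * c) + -(γ + (convOffset ℓ n j c'.1 : ℝ))
          by ring, Real.rpow_add h1s',
        show -(γ + (convOffset ℓ n j c'.2 : ℝ)) - 2 * c = -(2 * c) + -(γ + (convOffset ℓ n j c'.2 : ℝ))
          by ring, Real.rpow_add h1u']
      ring
    rw [Finset.sum_congr rfl fun c' _ => hsplit c', ← mul_sum,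
      sum_conv_eq hs0 hu0 h1s' h1u' Δ (A (n, j)) hq, ← hX, ← hY]
    ring
  -- bound the absolute sum
  have hbnd : ∑ c' ∈ antidiagonal j, K c' * (Bs c'.1 * Bu c'.2) ≤
      (s * u) ^ (-γ) * (4 : ℝ) ^ (-Δ) * (((1 - s ^ 2) ^ (-(4 * |c|)) * (1 - u ^ 2) ^ (-(4 * |c|))) *
        (A (n, j) * zMono (Δ + (n : ℝ)) j ((2 * s / (1 - s ^ 2)) ^ 2) ((2 * u / (1 - u ^ 2)) ^ 2))) := by
    -- exponent comparison
    have hexp : ∀ i : ℕ, -(4 * |c| + (γ + (convOffset ℓ n j i : ℝ))) ≤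
        -(|2 * c| + |-(γ + (convOffset ℓ n j i : ℝ)) - 2 * c|) := by
      intro i
      have h0 : 0 ≤ γ + (convOffset ℓ n j i : ℝ) := by positivity
      have h1 : |2 * c| = 2 * |c| := by rw [abs_mul, abs_two]
      have h2 : |-(γ + (convOffset ℓ n j i : ℝ)) - 2 * c| ≤ (γ + (convOffset ℓ n j i : ℝ)) + 2 * |c| := by
        calc |-(γ + (convOffset ℓ n j i : ℝ)) - 2 * c|
            ≤ |-(γ + (convOffset ℓ n j i : ℝ))| + |2 * c| := abs_sub _ _
          _ = (γ + (convOffset ℓ n j i : ℝ)) + 2 * |c| := by rw [abs_neg, abs_of_nonneg h0, h1]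
      linarith
    have hBs' : ∀ i : ℕ, Bs i ≤ (1 - s ^ 2) ^ (-(4 * |c|)) *
        (s ^ convOffset ℓ n j i * (1 - s ^ 2) ^ (-(γ + (convOffset ℓ n j i : ℝ)))) := by
      intro i
      rw [hBs]
      simp only
      rw [show (1 - s ^ 2) ^ (-(4 * |c|)) * (s ^ convOffset ℓ n j i *
          (1 - s ^ 2) ^ (-(γ + (convOffset ℓ n j i : ℝ)))) = s ^ convOffset ℓ n j i *
          ((1 - s ^ 2) ^ (-(4 * |c|)) * (1 - s ^ 2) ^ (-(γ + (convOffset ℓ n j i : ℝ)))) by ring,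
        ← Real.rpow_add h1s, show -(4 * |c|) + -(γ + (convOffset ℓ n j i : ℝ)) =
          -(4 * |c| + (γ + (convOffset ℓ n j i : ℝ))) by ring]
      exact mul_le_mul_of_nonneg_left
        (Real.rpow_le_rpow_of_exponent_ge h1s (by nlinarith) (hexp i)) (pow_nonneg hs0.le _)
    have hBu' : ∀ k : ℕ, Bu k ≤ (1 - u ^ 2) ^ (-(4 * |c|)) *
        (u ^ convOffset ℓ n j k * (1 - u ^ 2) ^ (-(γ + (convOffset ℓ n j k : ℝ)))) := by
      intro k
      rw [hBu]
      simp only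
      rw [show (1 - u ^ 2) ^ (-(4 * |c|)) * (u ^ convOffset ℓ n j k *
          (1 - u ^ 2) ^ (-(γ + (convOffset ℓ n j k : ℝ)))) = u ^ convOffset ℓ n j k *
          ((1 - u ^ 2) ^ (-(4 * |c|)) * (1 - u ^ 2) ^ (-(γ + (convOffset ℓ n j k : ℝ)))) by ring,
        ← Real.rpow_add h1u, show -(4 * |c|) + -(γ + (convOffset ℓ n j k : ℝ)) =
          -(4 * |c| + (γ + (convOffset ℓ n j k : ℝ))) by ring]
      exact mul_le_mul_of_nonneg_left
        (Real.rpow_le_rpow_of_exponent_ge h1u (by nlinarith) (hexp k)) (pow_nonneg hu0.le _)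
    have hBu0 : ∀ k : ℕ, 0 ≤ Bu k := fun k => by
      rw [hBu]; exact mul_nonneg (pow_nonneg hu0.le _) (Real.rpow_nonneg h1u.le _)
    have hBs0' : ∀ i : ℕ, 0 ≤ (1 - s ^ 2) ^ (-(4 * |c|)) *
        (s ^ convOffset ℓ n j i * (1 - s ^ 2) ^ (-(γ + (convOffset ℓ n j i : ℝ)))) := fun i => by
      have := Real.rpow_nonneg h1s.le (-(4 * |c|))
      have := Real.rpow_nonneg h1s.le (-(γ + (convOffset ℓ n j i : ℝ)))
      positivity
    calc ∑ c' ∈ antidiagonal j, K c' * (Bs c'.1 * Bu c'.2)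
        ≤ ∑ c' ∈ antidiagonal j, K c' * (((1 - s ^ 2) ^ (-(4 * |c|)) *
            (s ^ convOffset ℓ n j c'.1 * (1 - s ^ 2) ^ (-(γ + (convOffset ℓ n j c'.1 : ℝ))))) *
            ((1 - u ^ 2) ^ (-(4 * |c|)) *
            (u ^ convOffset ℓ n j c'.2 * (1 - u ^ 2) ^ (-(γ + (convOffset ℓ n j c'.2 : ℝ)))))) := by
          refine sum_le_sum fun c' _ => mul_le_mul_of_nonneg_left ?_ (hK0 c')
          exact mul_le_mul (hBs' c'.1) (hBu' c'.2) (hBu0 c'.2) (hBs0' c'.1)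
      _ = ((1 - s ^ 2) ^ (-(4 * |c|)) * (1 - u ^ 2) ^ (-(4 * |c|))) *
            ∑ c' ∈ antidiagonal j, A (n, j) * (4 : ℝ) ^ n * (legendreLam c'.1 * legendreLam c'.2) *
              ((s ^ convOffset ℓ n j c'.1 * (1 - s ^ 2) ^ (-(γ + (convOffset ℓ n j c'.1 : ℝ)))) *
                (u ^ convOffset ℓ n j c'.2 * (1 - u ^ 2) ^ (-(γ + (convOffset ℓ n j c'.2 : ℝ))))) := by
          rw [mul_sum]
          refine sum_congr rfl fun c' _ => ?_
          rw [hK]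
          ring
      _ = _ := by
          rw [sum_conv_eq hs0 hu0 h1s h1u Δ (A (n, j)) hq]
          ring
  refine ⟨?_, hA, hT.trans hbnd⟩
  rw [hval] at hS
  exact hS

/-! ### §5. Summing over the `z`-levels: the full conversion series -/

/-- A vanishing `z`-coefficient kills its conversion terms. [folklore] -/
theorem convTerm_eq_zero_of_coeff {c Δ : ℝ} {ℓ : ℕ} {A : ℕ × ℕ → ℝ} {q : ℕ × ℕ} (h : A q = 0)
    (s u : ℝ) (σ : (ℕ × ℕ) × (ℕ × ℕ)) : convTerm c Δ ℓ A s u (q, σ) = 0 := by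
  rw [convTerm_apply]
  split_ifs
  · rw [h]; ring
  · rfl

/-- `2s/(1-s²) < 1` for `0 < s < √2 - 1` (Hogervorst–Rychkov 2013 §3.1: the `z`-series composed with
`z = 4ρ/(1+ρ)²` regroups absolutely for `ρ < 3 - 2√2 = (√2-1)²`). [cite: HogervorstRychkov2013, §3.1] -/
theorem two_mul_div_one_sub_sq_lt_one {s : ℝ} (hs0 : 0 < s) (hs1 : s < Real.sqrt 2 - 1) :
    2 * s / (1 - s ^ 2) < 1 := by
  have h2 : Real.sqrt 2 ^ 2 = 2 := Real.sq_sqrt (by norm_num)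
  have hs1' : s + 1 < Real.sqrt 2 := by linarith
  have hsq : (s + 1) ^ 2 < 2 := by
    calc (s + 1) ^ 2 < Real.sqrt 2 ^ 2 := by gcongr
      _ = 2 := h2
  have hlt1 : s < 1 := by nlinarith
  have hpos : 0 < 1 - s ^ 2 := by nlinarith
  rw [div_lt_one hpos]
  nlinarith

/-- `√2 - 1 < 1`. [folklore] -/
theorem sqrt_two_sub_one_lt_one : Real.sqrt 2 - 1 < 1 := by
  have : Real.sqrt 2 < 2 := by
    rw [show (2 : ℝ) = Real.sqrt 4 by rw [show (4 : ℝ) = 2 ^ 2 by norm_num, Real.sqrt_sq (by norm_num)]]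
    exact Real.sqrt_lt_sqrt (by norm_num) (by norm_num)
  linarith

/-- `0 < √2 - 1`. [folklore] -/
theorem sqrt_two_sub_one_pos : 0 < Real.sqrt 2 - 1 := by
  have : 1 < Real.sqrt 2 := by
    rw [show (1 : ℝ) = Real.sqrt 1 by rw [Real.sqrt_one]]
    exact Real.sqrt_lt_sqrt (by norm_num) (by norm_num)
  linarith

/-- **The full conversion series.** For a non-negative `z`-array `A` supported on `j ≤ ℓ + n`,
`ℓ ≤ Δ`, whose `z`-series converges on the square to `G`, and a point `0 < s, u < √2 - 1` of the
square-root `ρ`-square: the conversion family `convTerm` over all indices has sum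
`(su)^{-(Δ-ℓ)} 4^{-Δ} (1-z(s²))^c (1-z(u²))^c G(z(s²), z(u²))` and is absolutely summable (dominated by
the `z`-series at the real point `((2s/(1-s²))², (2u/(1-u²))²)` of the square).
[cite: HogervorstRychkov2013, §3 "first method" and §3.1] -/
theorem hasSum_convTerm {c Δ : ℝ} {ℓ : ℕ} {A : ℕ × ℕ → ℝ} {G : ℝ → ℝ → ℝ} (hA0 : ∀ q, 0 ≤ A q)
    (hAs : RadialSupport ℓ A) (hΔ : (ℓ : ℝ) ≤ Δ)
    (hz : ∀ x y : ℝ, x ∈ Ioo (0 : ℝ) 1 → y ∈ Ioo (0 : ℝ) 1 →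
      HasSum (fun q : ℕ × ℕ => A q * zMono (Δ + (q.1 : ℝ)) q.2 x y) (G x y))
    {s u : ℝ} (hs0 : 0 < s) (hs1 : s < Real.sqrt 2 - 1) (hu0 : 0 < u) (hu1 : u < Real.sqrt 2 - 1) :
    HasSum (convTerm c Δ ℓ A s u)
        ((s * u) ^ (-(Δ - (ℓ : ℝ))) * (4 : ℝ) ^ (-Δ) *
          ((1 - zOfRho (s ^ 2)) ^ c * (1 - zOfRho (u ^ 2)) ^ c *
            G (zOfRho (s ^ 2)) (zOfRho (u ^ 2)))) ∧
      Summable (fun τ : ConvIndex => |convTerm c Δ ℓ A s u τ|) := by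
  have hs1' : s < 1 := hs1.trans sqrt_two_sub_one_lt_one
  have hu1' : u < 1 := hu1.trans sqrt_two_sub_one_lt_one
  -- the two real points of the `z`-square
  have hX : zOfRho (s ^ 2) ∈ Ioo (0 : ℝ) 1 :=
    ⟨zOfRho_pos (by positivity), zOfRho_lt_one (by nlinarith) (by nlinarith)⟩
  have hY : zOfRho (u ^ 2) ∈ Ioo (0 : ℝ) 1 :=
    ⟨zOfRho_pos (by positivity), zOfRho_lt_one (by nlinarith) (by nlinarith)⟩
  have hPs : 0 < 2 * s / (1 - s ^ 2) := div_pos (by positivity) (by nlinarith)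
  have hPu : 0 < 2 * u / (1 - u ^ 2) := div_pos (by positivity) (by nlinarith)
  have hXs : (2 * s / (1 - s ^ 2)) ^ 2 ∈ Ioo (0 : ℝ) 1 :=
    ⟨by positivity, by
      have := two_mul_div_one_sub_sq_lt_one hs0 hs1
      nlinarith⟩
  have hYs : (2 * u / (1 - u ^ 2)) ^ 2 ∈ Ioo (0 : ℝ) 1 :=
    ⟨by positivity, by
      have := two_mul_div_one_sub_sq_lt_one hu0 hu1
      nlinarith⟩
  set C₁ : ℝ := (s * u) ^ (-(Δ - (ℓ : ℝ))) * (4 : ℝ) ^ (-Δ) with hC₁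
  set V : ℝ := (1 - zOfRho (s ^ 2)) ^ c * (1 - zOfRho (u ^ 2)) ^ c with hV
  set W : ℝ := (1 - s ^ 2) ^ (-(4 * |c|)) * (1 - u ^ 2) ^ (-(4 * |c|)) with hW
  obtain ⟨hS, hA, -⟩ := hasSum_prod_assemble (U := convTerm c Δ ℓ A s u)
    (r := fun q : ℕ × ℕ => C₁ * (A q * (V * zMono (Δ + (q.1 : ℝ)) q.2 (zOfRho (s ^ 2)) (zOfRho (u ^ 2)))))
    (B := fun q : ℕ × ℕ => C₁ * (W * (A q *
      zMono (Δ + (q.1 : ℝ)) q.2 ((2 * s / (1 - s ^ 2)) ^ 2) ((2 * u / (1 - u ^ 2)) ^ 2))))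
    (S := C₁ * (V * G (zOfRho (s ^ 2)) (zOfRho (u ^ 2))))
    (T := C₁ * (W * G ((2 * s / (1 - s ^ 2)) ^ 2) ((2 * u / (1 - u ^ 2)) ^ 2)))
    (fun q => by
      by_cases hq : q.2 ≤ ℓ + q.1
      · have h := (hasSum_convTerm_level (c := c) hA0 hΔ hs0 hs1' hu0 hu1' q hq).1
        rw [hV]
        convert h using 1
      · have hA' : A q = 0 := hAs q (by omega)
        rw [show (fun σ : (ℕ × ℕ) × (ℕ × ℕ) => convTerm c Δ ℓ A s u (q, σ)) = fun _ => 0 from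
          funext fun σ => convTerm_eq_zero_of_coeff hA' s u σ, hA', zero_mul, mul_zero]
        exact hasSum_zero)
    (fun q => by
      by_cases hq : q.2 ≤ ℓ + q.1
      · exact (hasSum_convTerm_level (c := c) hA0 hΔ hs0 hs1' hu0 hu1' q hq).2.1
      · have hA' : A q = 0 := hAs q (by omega)
        rw [show (fun σ : (ℕ × ℕ) × (ℕ × ℕ) => |convTerm c Δ ℓ A s u (q, σ)|) = fun _ => 0 from
          funext fun σ => by rw [convTerm_eq_zero_of_coeff hA' s u σ, abs_zero]]
        exact summable_zero)
    (fun q => by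
      by_cases hq : q.2 ≤ ℓ + q.1
      · have h := (hasSum_convTerm_level (c := c) hA0 hΔ hs0 hs1' hu0 hu1' q hq).2.2
        rw [hW]
        refine h.trans (le_of_eq ?_)
        ring
      · have hA' : A q = 0 := hAs q (by omega)
        rw [show (fun σ : (ℕ × ℕ) × (ℕ × ℕ) => |convTerm c Δ ℓ A s u (q, σ)|) = fun _ => 0 from
          funext fun σ => by rw [convTerm_eq_zero_of_coeff hA' s u σ, abs_zero], tsum_zero, hA']
        simp)
    (by
      have h := ((hz _ _ hXs hYs).mul_left W).mul_left C₁
      exact h)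
    (by
      have h := ((hz _ _ hX hY).mul_left V).mul_left C₁
      refine h.congr_fun fun q => ?_
      ring)
  refine ⟨?_, hA⟩
  rw [hC₁, hV] at hS
  convert hS using 1

/-! ### §6. Regrouping by `(s,u)`-degree: the conversion array -/

/-- On the fibre `convDeg = p` the conversion term is the coefficient times the fixed monomial
`s^{p₁} u^{p₂}`. [folklore] -/
theorem tsum_fiber_convTerm (c Δ : ℝ) (ℓ : ℕ) (A : ℕ × ℕ → ℝ) (s u : ℝ) (p : ℕ × ℕ) :
    ∑' τ : ↥(convDeg ℓ ⁻¹' {p}), convTerm c Δ ℓ A s u (τ : ConvIndex) =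
      zRhoConv c Δ ℓ A p * (s ^ p.1 * u ^ p.2) := by
  unfold zRhoConv
  rw [← tsum_mul_right]
  refine tsum_congr fun τ => ?_
  have hτ : convDeg ℓ (τ : ConvIndex) = p := τ.2
  unfold convTerm
  rw [hτ]

/-- **The converted `z`-series as a double power series in `(s,u) = (√ρ, √ρ̄)`** on the small square
`0 < s, u < √2 - 1`: `Σ_p zRhoConv(p) s^{p₁} u^{p₂} = (su)^{-(Δ-ℓ)} 4^{-Δ} (1-z(s²))^c(1-z(u²))^c G(z(s²),z(u²))`.
[cite: HogervorstRychkov2013, §3 "first method"] -/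
theorem hasSum_zRhoConv {c Δ : ℝ} {ℓ : ℕ} {A : ℕ × ℕ → ℝ} {G : ℝ → ℝ → ℝ} (hA0 : ∀ q, 0 ≤ A q)
    (hAs : RadialSupport ℓ A) (hΔ : (ℓ : ℝ) ≤ Δ)
    (hz : ∀ x y : ℝ, x ∈ Ioo (0 : ℝ) 1 → y ∈ Ioo (0 : ℝ) 1 →
      HasSum (fun q : ℕ × ℕ => A q * zMono (Δ + (q.1 : ℝ)) q.2 x y) (G x y))
    {s u : ℝ} (hs0 : 0 < s) (hs1 : s < Real.sqrt 2 - 1) (hu0 : 0 < u) (hu1 : u < Real.sqrt 2 - 1) :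
    HasSum (fun p : ℕ × ℕ => zRhoConv c Δ ℓ A p * (s ^ p.1 * u ^ p.2))
      ((s * u) ^ (-(Δ - (ℓ : ℝ))) * (4 : ℝ) ^ (-Δ) *
        ((1 - zOfRho (s ^ 2)) ^ c * (1 - zOfRho (u ^ 2)) ^ c * G (zOfRho (s ^ 2)) (zOfRho (u ^ 2)))) := by
  have h := (hasSum_convTerm (c := c) hA0 hAs hΔ hz hs0 hs1 hu0 hu1).1.tsum_fiberwise (convDeg ℓ)
  simpa only [tsum_fiber_convTerm] using h

/-! ### §7. Identification of the radial table -/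

/-- Linearity of the `(s,u)`-monomial array in the table (scalars). [folklore] -/
theorem radialMonArr_smul (ℓ : ℕ) (κ : ℝ) (w : ℕ × ℕ → ℝ) (p : ℕ × ℕ) :
    radialMonArr ℓ (fun q => κ * w q) p = κ * radialMonArr ℓ w p := by
  unfold radialMonArr
  split_ifs
  · rw [mul_sum]
    exact sum_congr rfl fun j _ => by ring
  · rw [mul_zero]

/-- Linearity of the `(s,u)`-monomial array in the table (differences). [folklore] -/
theorem radialMonArr_sub (ℓ : ℕ) (w w' : ℕ × ℕ → ℝ) (p : ℕ × ℕ) :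
    radialMonArr ℓ (fun q => w q - w' q) p = radialMonArr ℓ w p - radialMonArr ℓ w' p := by
  unfold radialMonArr
  split_ifs
  · rw [← sum_sub_distrib]
    exact sum_congr rfl fun j _ => by ring
  · rw [sub_zero]

/-- A supported table with vanishing monomial array vanishes (the triangularity of
`RadialExpansionUniqueness`, level by level). [folklore] -/
theorem RadialSupport.eq_zero_of_radialMonArr_eq_zero {ℓ : ℕ} {d : ℕ × ℕ → ℝ} (hd : RadialSupport ℓ d)
    (h : radialMonArr ℓ d = 0) : d = 0 := by
  funext q
  obtain ⟨m, j⟩ := q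
  by_cases hj : ℓ + m < j
  · exact hd (m, j) hj
  · rw [not_lt] at hj
    have hlev : ∀ p ∈ antidiagonal (2 * (ℓ + m)),
        ∑ j' ∈ range (ℓ + m + 1), d (m, j') * radialArr (ℓ + m) j' p = 0 := by
      intro p hp
      rw [← radialMonArr_of_mem d hp, h, Pi.zero_apply]
    exact eq_zero_of_sum_radialArr_eq_zero (ℓ + m) (fun j' => d (m, j')) hlev j hj

/-- Two supported tables with the same monomial array coincide. [folklore] -/
theorem RadialSupport.eq_of_radialMonArr_eq {ℓ : ℕ} {w w' : ℕ × ℕ → ℝ} (hw : RadialSupport ℓ w)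
    (hw' : RadialSupport ℓ w') (h : radialMonArr ℓ w = radialMonArr ℓ w') : w = w' := by
  have hd := (hw.sub hw').eq_zero_of_radialMonArr_eq_zero (by
    funext p
    rw [radialMonArr_sub, h, sub_self, Pi.zero_apply])
  funext q
  have := congrFun hd q
  simpa only [Pi.zero_apply, sub_eq_zero] using this

/-- **Identification of the radial table (Hogervorst–Rychkov 2013 §3, "first method", as a theorem).**
Let `G` have on the square `(0,1)²` a `z`-expansion `G = Σ_q A_q 𝒫_{Δ+n,j}(z,z̄)` with a non-negative
array `A` supported on `j ≤ ℓ + n` (`ℓ ≤ Δ`), and let `((1-z)(1-z̄))^c G` have a radial expansion with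
table `w` supported on `j ≤ ℓ + m` (`HasRadialExpansion c Δ w G`). Then the `(√ρ,√ρ̄)`-monomial array of
`w` IS the finite conversion array of `A`: `radialMonArr ℓ w = zRhoConv c Δ ℓ A`. In particular `w` is
determined by `A` (`RadialSupport.eq_of_radialMonArr_eq`). Proof: on the small square `ρ, ρ̄ < 3 - 2√2`
both expansions regroup absolutely into double power series in `(√ρ, √ρ̄)` with the same sum
(`hasSum_radialMonArr`, `hasSum_zRhoConv`); identity theorem. No analytic continuation is used: the
EXISTENCE of the radial expansion on the square is the hypothesis.
[cite: HogervorstRychkov2013, §3 "first method"] -/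
theorem radialMonArr_eq_zRhoConv_of_hasSum {c Δ : ℝ} {ℓ : ℕ} {A w : ℕ × ℕ → ℝ} {G : ℝ → ℝ → ℝ}
    (hA0 : ∀ q, 0 ≤ A q) (hAs : RadialSupport ℓ A) (hΔ : (ℓ : ℝ) ≤ Δ)
    (hz : ∀ x y : ℝ, x ∈ Ioo (0 : ℝ) 1 → y ∈ Ioo (0 : ℝ) 1 →
      HasSum (fun q : ℕ × ℕ => A q * zMono (Δ + (q.1 : ℝ)) q.2 x y) (G x y))
    (hw : RadialSupport ℓ w) (hρ : HasRadialExpansion c Δ w G) :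
    radialMonArr ℓ w = zRhoConv c Δ ℓ A := by
  have h4 : (0 : ℝ) < (4 : ℝ) ^ Δ := Real.rpow_pos_of_pos (by norm_num) Δ
  have h44 : (4 : ℝ) ^ Δ * (4 : ℝ) ^ (-Δ) = 1 := by
    rw [Real.rpow_neg (by norm_num : (0 : ℝ) ≤ 4), mul_inv_cancel₀ h4.ne']
  -- the difference array vanishes: identity theorem on `(0, √2 - 1)²`
  have hL : (fun p : ℕ × ℕ => radialMonArr ℓ (fun q => (4 : ℝ) ^ Δ * w q) p -
      (4 : ℝ) ^ Δ * zRhoConv c Δ ℓ A p) = 0 := by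
    refine eq_zero_of_double_tsum_eq_zero_of_pos _ sqrt_two_sub_one_pos ?_
    intro s u hs0 hs1 hu0 hu1
    have hs1' : s < 1 := hs1.trans sqrt_two_sub_one_lt_one
    have hu1' : u < 1 := hu1.trans sqrt_two_sub_one_lt_one
    have hX : zOfRho (s ^ 2) ∈ Ioo (0 : ℝ) 1 :=
      ⟨zOfRho_pos (by positivity), zOfRho_lt_one (by nlinarith) (by nlinarith)⟩
    have hY : zOfRho (u ^ 2) ∈ Ioo (0 : ℝ) 1 :=
      ⟨zOfRho_pos (by positivity), zOfRho_lt_one (by nlinarith) (by nlinarith)⟩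
    -- radial side, regrouped in `(s,u)`
    have hR1 : HasSum (fun q : ℕ × ℕ => ((4 : ℝ) ^ Δ * w q) * zMono (Δ + (q.1 : ℝ)) q.2 (s ^ 2) (u ^ 2))
        (((1 - zOfRho (s ^ 2)) * (1 - zOfRho (u ^ 2))) ^ c * G (zOfRho (s ^ 2)) (zOfRho (u ^ 2))) := by
      refine (hρ _ _ hX hY).congr_fun fun q => ?_
      simp only [radialMono, rhoOf_zOfRho (by nlinarith : (-1 : ℝ) < s ^ 2) (by nlinarith : s ^ 2 ≤ 1),
        rhoOf_zOfRho (by nlinarith : (-1 : ℝ) < u ^ 2) (by nlinarith : u ^ 2 ≤ 1)]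
    have hR := hasSum_radialMonArr (hw.mul_left _) hs0 hu0 hR1
    -- `z` side, converted
    have hZ := (hasSum_zRhoConv (c := c) hA0 hAs hΔ hz hs0 hs1 hu0 hu1).mul_left ((4 : ℝ) ^ Δ)
    have hv : ((1 - zOfRho (s ^ 2)) * (1 - zOfRho (u ^ 2))) ^ c =
        (1 - zOfRho (s ^ 2)) ^ c * (1 - zOfRho (u ^ 2)) ^ c :=
      Real.mul_rpow (by linarith [hX.2]) (by linarith [hY.2])
    have hD := hR.sub hZ
    have hzero : (s * u) ^ (-(Δ - (ℓ : ℝ))) * (((1 - zOfRho (s ^ 2)) * (1 - zOfRho (u ^ 2))) ^ c *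
        G (zOfRho (s ^ 2)) (zOfRho (u ^ 2))) - (4 : ℝ) ^ Δ * ((s * u) ^ (-(Δ - (ℓ : ℝ))) * (4 : ℝ) ^ (-Δ) *
          ((1 - zOfRho (s ^ 2)) ^ c * (1 - zOfRho (u ^ 2)) ^ c * G (zOfRho (s ^ 2)) (zOfRho (u ^ 2)))) = 0 := by
      rw [hv]
      calc (s * u) ^ (-(Δ - (ℓ : ℝ))) * ((1 - zOfRho (s ^ 2)) ^ c * (1 - zOfRho (u ^ 2)) ^ c *
              G (zOfRho (s ^ 2)) (zOfRho (u ^ 2))) - (4 : ℝ) ^ Δ * ((s * u) ^ (-(Δ - (ℓ : ℝ))) *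
              (4 : ℝ) ^ (-Δ) * ((1 - zOfRho (s ^ 2)) ^ c * (1 - zOfRho (u ^ 2)) ^ c *
                G (zOfRho (s ^ 2)) (zOfRho (u ^ 2))))
          = (1 - (4 : ℝ) ^ Δ * (4 : ℝ) ^ (-Δ)) * ((s * u) ^ (-(Δ - (ℓ : ℝ))) *
              ((1 - zOfRho (s ^ 2)) ^ c * (1 - zOfRho (u ^ 2)) ^ c * G (zOfRho (s ^ 2)) (zOfRho (u ^ 2)))) := by
            ring
        _ = 0 := by rw [h44]; ring
    rw [hzero] at hD
    have hD' : HasSum (fun p : ℕ × ℕ => (radialMonArr ℓ (fun q => (4 : ℝ) ^ Δ * w q) p -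
        (4 : ℝ) ^ Δ * zRhoConv c Δ ℓ A p) * s ^ p.1 * u ^ p.2) 0 := by
      refine hD.congr_fun fun p => ?_
      ring
    exact ⟨hD'.summable, hD'.tsum_eq⟩
  funext p
  have hp := congrFun hL p
  simp only [Pi.zero_apply, sub_eq_zero, radialMonArr_smul] at hp
  exact mul_left_cancel₀ h4.ne' hp

/-- `ℓ ≤ Δ` strictly above the unitarity bound. [folklore] -/
theorem natCast_le_of_unitarityBound3D_lt {ℓ : ℕ} {Δ : ℝ} (hΔ : unitarityBound3D ℓ < Δ) : (ℓ : ℝ) ≤ Δ := by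
  unfold unitarityBound3D at hΔ
  split_ifs at hΔ with h0
  · rw [h0]; push_cast; linarith
  · linarith

/-- **The radial table of a typed block is the conversion of its `z`-array.** For a genuine block
`g = g^{Δ₁₂,Δ₃₄}_{Δ,ℓ}` with `Δ₁₂ = -Δ₃₄` (the `⟨εσσε⟩` family, `z`-array `A_{n,j}(Δ₃₄/2,Δ₃₄/2)/λ_ℓ ≥ 0`,
`BlockZSeriesAB`) at a regular `(Δ,ℓ)`, ANY supported radial expansion table of `((1-z)(1-z̄))^c g` has
monomial array `zRhoConv c Δ ℓ (A/λ_ℓ)` — so it is unique and computable from the Dolan–Osborn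
recursion by finite conversion (two exact implementations: pub-ising3d-lit-g4 `chpt_recurrence.py`,
`rhoseries.py`). The EXISTENCE of such a table is not asserted (it is the content of a radial block
clause A2ρ). [cite: HogervorstRychkov2013, §3 "first method"] -/
theorem IsConformalBlock3D.radialMonArr_eq_zRhoConv {Δ₁₂ Δ₃₄ Δ c : ℝ} {ℓ : ℕ} {g : ℝ → ℝ → ℝ}
    {w : ℕ × ℕ → ℝ} (hΔ : unitarityBound3D ℓ < Δ) (hreg : ¬ accidentalDegeneracy3D Δ ℓ)
    (hab : Δ₁₂ = -Δ₃₄) (hg : IsConformalBlock3D Δ₁₂ Δ₃₄ Δ ℓ g) (hw : RadialSupport ℓ w)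
    (hρ : HasRadialExpansion c Δ w g) :
    radialMonArr ℓ w =
      zRhoConv c Δ ℓ (fun q => hrCoeffAB (Δ₃₄ / 2) (Δ₃₄ / 2) Δ ℓ q.1 q.2 / legendreLam ℓ) := by
  refine radialMonArr_eq_zRhoConv_of_hasSum
    (fun q => div_nonneg (hrCoeffAB_self_nonneg _ hΔ _ _) (legendreLam_pos ℓ).le)
    (fun q hq => by rw [hrCoeffAB_eq_zero_of_lt _ _ _ hq, zero_div])
    (natCast_le_of_unitarityBound3D_lt hΔ) (fun x y hx hy => ?_) hw hρ
  exact (hg.hasSum_hrZTermAB hΔ hreg hab hx hy).congr_fun fun q => rfl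

/-- **Under the radial pair clause the table is the converted Dolan–Osborn array.** At a regular
`(Δ, ℓ)` where `RadialPairClause Δσ Δε Δ ℓ` holds, for any typed odd-sector pair `(g₁, g₂)` the clause's
(unique) table `wr` has `radialMonArr ℓ wr = zRhoConv (Δσε/2) Δ ℓ (A^{⟨εσσε⟩}/λ_ℓ)`, `Δσε = Δσ - Δε`,
with `A^{⟨εσσε⟩}_{n,j} = hrCoeffAB (Δσε/2) (Δσε/2) Δ ℓ n j`: the head-cell tables of a radial-frame
certificate are CONSEQUENCES of the typed `z`-frame data, not additional input.
[cite: CostaHansenPenedonesTrevisani2016, §2.1 eq. (2.11)] -/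
theorem RadialPairClause.radialMonArr_eq_zRhoConv {Δσ Δε Δ : ℝ} {ℓ : ℕ}
    (h : RadialPairClause Δσ Δε Δ ℓ) (hΔ : unitarityBound3D ℓ < Δ) (hreg : ¬ accidentalDegeneracy3D Δ ℓ)
    {g₁ g₂ : ℝ → ℝ → ℝ} (hg₁ : IsConformalBlock3D (Δσ - Δε) (Δσ - Δε) Δ ℓ g₁)
    (hg₂ : IsConformalBlock3D (-(Δσ - Δε)) (Δσ - Δε) Δ ℓ g₂) :
    ∃ wr : ℕ × ℕ → ℝ, (∀ q, 0 ≤ wr q) ∧ RadialSupport ℓ wr ∧ HasSignedRadialExpansion Δ wr g₁ ∧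
      HasRadialExpansion ((Δσ - Δε) / 2) Δ wr g₂ ∧
        radialMonArr ℓ wr = zRhoConv ((Δσ - Δε) / 2) Δ ℓ
          (fun q => hrCoeffAB ((Δσ - Δε) / 2) ((Δσ - Δε) / 2) Δ ℓ q.1 q.2 / legendreLam ℓ) := by
  obtain ⟨wr, hw, hsupp, h₁, h₂⟩ := h g₁ g₂ hg₁ hg₂
  exact ⟨wr, hw, hsupp, h₁, h₂, hg₂.radialMonArr_eq_zRhoConv hΔ hreg rfl hsupp h₂⟩

/-! ### §8. The conversion array as an explicit finite sum (for evaluation in head cells) -/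

/-- A finite box of conversion indices carrying the whole support of the conversion coefficients in the
fibre `convDeg ℓ τ = (a,b)` when the `z`-array is supported on the descendant range: `n ≤ a+b`,
`j ≤ ℓ+a+b`, `i, t ≤ a`, `k, t' ≤ b`, filtered to the fibre. [folklore] -/
def convBox (ℓ : ℕ) (p : ℕ × ℕ) : Finset ConvIndex :=
  ((range (p.1 + p.2 + 1) ×ˢ range (ℓ + p.1 + p.2 + 1)) ×ˢ
    ((range (p.1 + 1) ×ˢ range (p.2 + 1)) ×ˢ (range (p.1 + 1) ×ˢ range (p.2 + 1)))).filter
    (fun τ => convDeg ℓ τ = p)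

/-- Membership in the box, unfolded. [folklore] -/
theorem mem_convBox {ℓ : ℕ} {p : ℕ × ℕ} {τ : ConvIndex} :
    τ ∈ convBox ℓ p ↔ (τ.1.1 ≤ p.1 + p.2 ∧ τ.1.2 ≤ ℓ + p.1 + p.2) ∧
      ((τ.2.1.1 ≤ p.1 ∧ τ.2.1.2 ≤ p.2) ∧ (τ.2.2.1 ≤ p.1 ∧ τ.2.2.2 ≤ p.2)) ∧ convDeg ℓ τ = p := by
  unfold convBox
  simp only [Finset.mem_filter, Finset.mem_product, Finset.mem_range, Nat.lt_succ_iff]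
  tauto

/-- Off the box, a conversion coefficient in the fibre of `p` vanishes (the `z`-array being supported on
`j ≤ ℓ + n`). [folklore] -/
theorem convCoeff_eq_zero_of_not_mem_convBox (c Δ : ℝ) {ℓ : ℕ} {A : ℕ × ℕ → ℝ}
    (hAs : RadialSupport ℓ A) {p : ℕ × ℕ} {τ : ConvIndex} (hτ : convDeg ℓ τ = p)
    (hn : τ ∉ convBox ℓ p) : convCoeff c Δ ℓ A τ = 0 := by
  unfold convCoeff
  split_ifs with hik
  · by_cases hj : τ.1.2 ≤ ℓ + τ.1.1
    · exfalso
      apply hn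
      have h1 := congrArg Prod.fst hτ
      have h2 := congrArg Prod.snd hτ
      unfold convDeg convOffset at h1 h2
      simp only at h1 h2
      rw [mem_convBox]
      exact ⟨⟨by omega, by omega⟩, ⟨⟨by omega, by omega⟩, ⟨by omega, by omega⟩⟩, hτ⟩
    · rw [hAs τ.1 (not_le.mp hj)]
      ring
  · rfl

/-- **The conversion array is a finite sum**: under the support condition on the `z`-array,
`zRhoConv c Δ ℓ A (a,b) = Σ_{τ ∈ convBox ℓ (a,b)} convCoeff c Δ ℓ A τ` — an explicitly evaluable
expression (finitely many products of `A_{n,j}`, `4^n λ_iλ_k` and two binomial coefficients `binomE`).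
[cite: HogervorstRychkov2013, §3 "first method"] -/
theorem zRhoConv_eq_sum_convBox (c Δ : ℝ) {ℓ : ℕ} {A : ℕ × ℕ → ℝ} (hAs : RadialSupport ℓ A)
    (p : ℕ × ℕ) : zRhoConv c Δ ℓ A p = ∑ τ ∈ convBox ℓ p, convCoeff c Δ ℓ A τ := by
  unfold zRhoConv
  rw [tsum_subtype (convDeg ℓ ⁻¹' {p}) (convCoeff c Δ ℓ A), tsum_eq_sum (s := convBox ℓ p)]
  · refine Finset.sum_congr rfl fun τ hτ => ?_
    exact Set.indicator_of_mem (show τ ∈ convDeg ℓ ⁻¹' {p} from (mem_convBox.mp hτ).2.2) _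
  · intro τ hτ
    by_cases hmem : τ ∈ convDeg ℓ ⁻¹' {p}
    · rw [Set.indicator_of_mem hmem]
      exact convCoeff_eq_zero_of_not_mem_convBox c Δ hAs hmem hτ
    · exact Set.indicator_of_notMem hmem _

/-- The radial table's monomial array of a typed conjugate-pair block as an explicit finite sum of
conversion coefficients of the Dolan–Osborn array (combine `IsConformalBlock3D.radialMonArr_eq_zRhoConv`
with `zRhoConv_eq_sum_convBox`). [cite: HogervorstRychkov2013, §3 "first method"] -/
theorem IsConformalBlock3D.radialMonArr_eq_sum_convBox {Δ₁₂ Δ₃₄ Δ c : ℝ} {ℓ : ℕ} {g : ℝ → ℝ → ℝ}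
    {w : ℕ × ℕ → ℝ} (hΔ : unitarityBound3D ℓ < Δ) (hreg : ¬ accidentalDegeneracy3D Δ ℓ)
    (hab : Δ₁₂ = -Δ₃₄) (hg : IsConformalBlock3D Δ₁₂ Δ₃₄ Δ ℓ g) (hw : RadialSupport ℓ w)
    (hρ : HasRadialExpansion c Δ w g) (p : ℕ × ℕ) :
    radialMonArr ℓ w p = ∑ τ ∈ convBox ℓ p,
      convCoeff c Δ ℓ (fun q : ℕ × ℕ => hrCoeffAB (Δ₃₄ / 2) (Δ₃₄ / 2) Δ ℓ q.1 q.2 / legendreLam ℓ) τ := by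
  rw [hg.radialMonArr_eq_zRhoConv hΔ hreg hab hw hρ]
  exact zRhoConv_eq_sum_convBox c Δ
    (fun q hq => show hrCoeffAB (Δ₃₄ / 2) (Δ₃₄ / 2) Δ ℓ q.1 q.2 / legendreLam ℓ = 0 by
      rw [hrCoeffAB_eq_zero_of_lt _ _ _ hq, zero_div]) p

end Literature.MathematicalPhysics.QuantumFieldTheory.ConformalBootstrap3D
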